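import Literature.Algebra.Homology.StaircasePresentation
import Literature.Algebra.Homology.StaircaseRetraction
import Literature.AlgebraicGeometry.Crystalline.HuComplexes
import HarnessLib

/-!
# X. Hu's complexes as quotients of Bloch–Esnault–Kerz-type staircase complexes

Continuation of `Crystalline/HuComplexes`. For an `A`-scheme `X`, an integer `q` and `r M : ℕ`,
the **staircase de Rham complex**

`deRhamStaircase X q r M = q^{(r-•)M} Ω• = [q^{rM}𝒪 → q^{(r-1)M}Ω¹ → ⋯ → q^{M}Ω^{r-1} → Ωʳ → Ωʳ⁺¹ → ⋯]`

is the staircase image subcomplex (`Algebra/Homology/StaircaseComplexes.powImage`) of the algebraic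
de Rham complex `Ω• = algebraicDeRhamComplex X` (`Crystalline/DeRhamComplexSheaf`) for the
exponents `(r - j) M`; for `M = 1` it is Bloch–Esnault–Kerz's `p(r)Ω•_{X}`
(arXiv:1203.2776, §2; X. Hu, arXiv:2507.12458, Def. 8.1), for `M = 0` it is (isomorphic to) `Ω•`.
The point of this file is the PRESENTATION of Hu's complex `p^{r,M}_{r,N}Ω• = huComplex X q r M N`
(Def. 8.2: the staircase image `q^{(r-•)M}` inside the staircase reduction `Ω•/q^{(r-•)N}`) as the
quotient of two staircase de Rham complexes:

`0 ⟶ q^{(r-•)N}Ω• ⟶ q^{(r-•)M}Ω• ⟶ p^{r,M}_{r,N}Ω• ⟶ 0`   (`M ≤ N`; `huPresentation_shortExact`),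

a short exact sequence of complexes of abelian sheaves for EVERY `X` and `q` (no torsion
hypothesis; `Algebra/Homology/StaircasePresentation.staircasePresentation_shortExact`), together
with

* its extension by zero to `ℤ`-indexed complexes (`huPresentationInt`,
  `huPresentationInt_shortExact`), whose third object is LITERALLY `huComplexInt X q r M N` — the
  complex whose hypercohomology `ℍⁱ` (`Crystalline/SheafHypercohomology`) is the carrier
  `KTheory.huH` of Hu's obstruction / kernel groups (`KTheory/HuInfinitesimalKZero`) — so that the
  long exact hyper-Ext sequences (`Algebra/Homology/HyperExt`: `HyperExt.delta`, `exact₁/₂/₃_apply`,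
  `delta_naturality`) present `ℍⁱ(p^{r,M}_{r,N}Ω•)` by the hypercohomology of the staircase de Rham
  complexes, which are retracts of `Ω•` up to `q^{rM}` (`Algebra/Homology/StaircaseRetraction`);
* NATURALITY: the morphisms of short complexes over Hu's reduction maps
  `p^{r,M}_{r,N'}Ω• → p^{r,M}_{r,N}Ω•` (`huPresentationMapOfLE`, `N ≤ N'`, first component the
  inclusion `q^{(r-•)N'}Ω• ⊆ q^{(r-•)N}Ω•`) and over Hu's inclusions `p^{r,M}_{r,N} ⊆ p^{r,M'}_{r,N}`
  (`huPresentationMapOfLE'`, `M' ≤ M`), and their `ℤ`-extensions, whose third components are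
  `huComplexIntReduce` / `huComplexIntLE`;
* the `ℤ`-extension of Hu's three-term short exact sequences
  `0 → p^{r,M}_{r,N} → p^{r,M'}_{r,N} → p^{r,M'}_{r,M} → 0` (`hu_shortExact_int`).

[folklore] Homological algebra on cited objects; everything is proved, no named facts. NOT here:
the identification of the terms `q^{(r-j)M}Ωʲ ≅ Ωʲ` under `q`-torsion-freeness
(`StaircaseRetraction.powImageXIso` with `Crystalline/DeRhamComplexTorsionFree`), hypercohomology
statements.
-/

noncomputable section

namespace Literature.AlgebraicGeometry.Crystalline

open CategoryTheory CategoryTheory.Limits _root_.AlgebraicGeometry _root_.TopologicalSpace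
  Literature.Algebra.Homology

universe u

variable {A : Type u} [CommRing A] (X : Over (Spec (CommRingCat.of A))) (q : ℤ)

/-! ### The staircase de Rham complexes `q^{(r-•)M} Ω•` -/

/-- **The staircase de Rham complex `q^{(r-•)M}Ω• = [q^{rM}𝒪 → q^{(r-1)M}Ω¹ → ⋯ → q^{M}Ω^{r-1} → Ωʳ →
⋯]`**, the staircase image subcomplex of the algebraic de Rham complex of `X` for the exponents
`(r - j) M` (Bloch–Esnault–Kerz's `p(r)Ω•_X` for `M = 1`, arXiv:1203.2776 §2; X. Hu,
arXiv:2507.12458, Def. 8.1). [folklore] -/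
abbrev deRhamStaircase (r M : ℕ) :
    CochainComplex (Sheaf (Opens.grothendieckTopology X.left) AddCommGrpCat.{u}) ℕ :=
  powImage (algebraicDeRhamComplex X) q (antitone_staircase r M)

/-- The inclusion `q^{(r-•)M}Ω• ⟶ Ω•`. [folklore] -/
abbrev deRhamStaircaseι (r M : ℕ) : deRhamStaircase X q r M ⟶ algebraicDeRhamComplex X :=
  powImageι (algebraicDeRhamComplex X) q (antitone_staircase r M)

/-- The inclusion `q^{(r-•)M'}Ω• ⟶ q^{(r-•)M}Ω•` for `M ≤ M'`. [folklore] -/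
abbrev deRhamStaircaseLE (r : ℕ) {M M' : ℕ} (h : M ≤ M') :
    deRhamStaircase X q r M' ⟶ deRhamStaircase X q r M :=
  powImageLE (algebraicDeRhamComplex X) q (antitone_staircase r M) (antitone_staircase r M')
    (staircase_le_staircase r h)

/-- The inclusions `deRhamStaircaseLE` are compatible with the inclusions into `Ω•`. [folklore] -/
theorem deRhamStaircaseLE_comp_deRhamStaircaseι (r : ℕ) {M M' : ℕ} (h : M ≤ M') :
    deRhamStaircaseLE X q r h ≫ deRhamStaircaseι X q r M = deRhamStaircaseι X q r M' :=
  powImageLE_comp_powImageι _ _ _ _ _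

/-- The inclusions `deRhamStaircaseLE` are transitive. [folklore] -/
theorem deRhamStaircaseLE_comp (r : ℕ) {M M' M'' : ℕ} (h : M ≤ M') (h' : M' ≤ M'') :
    deRhamStaircaseLE X q r h' ≫ deRhamStaircaseLE X q r h = deRhamStaircaseLE X q r (h.trans h') :=
  powImageLE_comp _ _ _ _ _ _ _

/-- `deRhamStaircaseLE` for `M ≤ M` is the identity. [folklore] -/
theorem deRhamStaircaseLE_refl (r M : ℕ) : deRhamStaircaseLE X q r (le_refl M) = 𝟙 _ :=
  powImageLE_refl _ _ _

/-- In degrees `j ≥ r` (past the staircase, exponent `0`) the inclusion `q^{(r-•)M}Ω• ⟶ Ω•` is an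
isomorphism on terms. [folklore] -/
theorem isIso_deRhamStaircaseι_f (r M : ℕ) {j : ℕ} (hj : r ≤ j) :
    IsIso ((deRhamStaircaseι X q r M).f j) :=
  isIso_powImageι_f _ q (antitone_staircase r M)
    (show (r - j) * M = 0 by rw [Nat.sub_eq_zero_of_le hj, zero_mul])

/-! ### Hu's complex as a quotient: the presentation -/

/-- **The projection `q^{(r-•)M}Ω• ⟶ p^{r,M}_{r,N}Ω•`** onto Hu's complex (push-forward of the
staircase images along `Ω• ⟶ Ω•/q^{(r-•)N}`). [folklore] -/
abbrev huComplexπ (r M N : ℕ) : deRhamStaircase X q r M ⟶ huComplex X q r M N :=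
  powImageToQuotient (algebraicDeRhamComplex X) q (antitone_staircase r M) (antitone_staircase r N)

/-- The projection is compatible with the inclusions and the projection `Ω• ⟶ Ω•/q^{(r-•)N}`:
`(proj) ≫ (p^{r,M}_{r,N} ⊆ Ω•/q^{(r-•)N}) = (q^{(r-•)M}Ω• ⊆ Ω•) ≫ (Ω• → Ω•/q^{(r-•)N})`. [folklore] -/
theorem huComplexπ_comp_huComplexι (r M N : ℕ) :
    huComplexπ X q r M N ≫ huComplexι X q r M N = deRhamStaircaseι X q r M ≫ deRhamReductionπ X q r N :=
  powImageMap_comp_powImageι _ _ _ _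

/-- The projection is degreewise an epimorphism. [folklore] -/
instance epi_huComplexπ_f (r M N j : ℕ) : Epi ((huComplexπ X q r M N).f j) :=
  epi_powImageToQuotient_f _ _ _ _ _

/-- The projections are compatible with Hu's reductions:
`(q^{(r-•)M}Ω• → p^{r,M}_{r,N'}) ≫ (p^{r,M}_{r,N'} → p^{r,M}_{r,N}) = (q^{(r-•)M}Ω• → p^{r,M}_{r,N})`
for `N ≤ N'`. [folklore] -/
theorem huComplexπ_comp_huComplexReduce (r M : ℕ) {N N' : ℕ} (h : N ≤ N') :
    huComplexπ X q r M N' ≫ huComplexReduce X q r M h = huComplexπ X q r M N :=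
  powImageToQuotient_comp_powImageMap_powQuotientMap _ _ _ _ _ _

/-- The projections are compatible with the inclusions:
`(q^{(r-•)M}Ω• ⊆ q^{(r-•)M'}Ω•) ≫ (→ p^{r,M'}_{r,N}) = (→ p^{r,M}_{r,N}) ≫ (p^{r,M}_{r,N} ⊆ p^{r,M'}_{r,N})`
for `M' ≤ M`. [folklore] -/
theorem deRhamStaircaseLE_comp_huComplexπ (r : ℕ) {M M' : ℕ} (h : M' ≤ M) (N : ℕ) :
    deRhamStaircaseLE X q r h ≫ huComplexπ X q r M' N = huComplexπ X q r M N ≫ huComplexLE X q r h N :=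
  powImageLE_comp_powImageMap_eq _ _ _ _ _ _

/-- **The presentation of Hu's complex**: the three-term sequence
`q^{(r-•)N}Ω• ⟶ q^{(r-•)M}Ω• ⟶ p^{r,M}_{r,N}Ω•` (`M ≤ N`) as a short complex of cochain complexes of
abelian sheaves. [folklore] -/
abbrev huPresentation (r : ℕ) {M N : ℕ} (h : M ≤ N) :
    ShortComplex (CochainComplex (Sheaf (Opens.grothendieckTopology X.left) AddCommGrpCat.{u}) ℕ) :=
  staircasePresentationShortComplex (algebraicDeRhamComplex X) q (antitone_staircase r M)
    (antitone_staircase r N) (staircase_le_staircase r h)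

/-- The objects of the presentation are `q^{(r-•)N}Ω•`, `q^{(r-•)M}Ω•` and Hu's `p^{r,M}_{r,N}Ω•`
(definitionally). [folklore] -/
theorem huPresentation_X (r : ℕ) {M N : ℕ} (h : M ≤ N) :
    (huPresentation X q r h).X₁ = deRhamStaircase X q r N ∧
      (huPresentation X q r h).X₂ = deRhamStaircase X q r M ∧
        (huPresentation X q r h).X₃ = huComplex X q r M N :=
  ⟨rfl, rfl, rfl⟩

/-- The maps of the presentation are the inclusion and the projection (definitionally).
[folklore] -/
theorem huPresentation_f_g (r : ℕ) {M N : ℕ} (h : M ≤ N) :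
    (huPresentation X q r h).f = deRhamStaircaseLE X q r h ∧
      (huPresentation X q r h).g = huComplexπ X q r M N :=
  ⟨rfl, rfl⟩

/-- **Hu's complex is the quotient `q^{(r-•)M}Ω• / q^{(r-•)N}Ω•`**: the presentation
`0 → q^{(r-•)N}Ω• → q^{(r-•)M}Ω• → p^{r,M}_{r,N}Ω• → 0` is a short exact sequence of complexes of
abelian sheaves, for every `A`-scheme `X`, every `q` and `M ≤ N` (X. Hu, arXiv:2507.12458,
Def. 8.1–8.2: `p^{r,M}_{r,N}Ω•` has terms `p^{(r-j)M}Ωʲ_{X_{(r-j)N}} = p^{(r-j)M}Ωʲ / p^{(r-j)N}Ωʲ`).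
[folklore] -/
theorem huPresentation_shortExact (r : ℕ) {M N : ℕ} (h : M ≤ N) :
    (huPresentation X q r h).ShortExact :=
  staircasePresentation_shortExact _ _ _ _ _

/-- **Naturality of the presentation over Hu's reductions**: for `M ≤ N ≤ N'` the morphism of
short complexes `(q^{(r-•)N'}Ω• → q^{(r-•)M}Ω• → p^{r,M}_{r,N'}) ⟶ (q^{(r-•)N}Ω• → q^{(r-•)M}Ω• →
p^{r,M}_{r,N})` with components the inclusion `q^{(r-•)N'} ⊆ q^{(r-•)N}`, the identity, and Hu's
reduction `huComplexReduce`. [folklore] -/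
abbrev huPresentationMapOfLE (r : ℕ) {M N N' : ℕ} (h : M ≤ N) (h' : N ≤ N') :
    huPresentation X q r (h.trans h') ⟶ huPresentation X q r h :=
  staircasePresentationMapOfLE (algebraicDeRhamComplex X) q (antitone_staircase r M)
    (antitone_staircase r N) (antitone_staircase r N') (staircase_le_staircase r h)
    (staircase_le_staircase r h')

/-- The components of `huPresentationMapOfLE` are `deRhamStaircaseLE`, `𝟙`, `huComplexReduce`
(definitionally). [folklore] -/
theorem huPresentationMapOfLE_τ (r : ℕ) {M N N' : ℕ} (h : M ≤ N) (h' : N ≤ N') :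
    (huPresentationMapOfLE X q r h h').τ₁ = deRhamStaircaseLE X q r h' ∧
      (huPresentationMapOfLE X q r h h').τ₂ = 𝟙 _ ∧
        (huPresentationMapOfLE X q r h h').τ₃ = huComplexReduce X q r M h' :=
  ⟨rfl, rfl, rfl⟩

/-- **Naturality of the presentation over Hu's inclusions**: for `M' ≤ M ≤ N` the morphism of
short complexes `(q^{(r-•)N}Ω• → q^{(r-•)M}Ω• → p^{r,M}_{r,N}) ⟶ (q^{(r-•)N}Ω• → q^{(r-•)M'}Ω• →
p^{r,M'}_{r,N})` with components the identity, the inclusion `q^{(r-•)M} ⊆ q^{(r-•)M'}`, and Hu's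
inclusion `huComplexLE`. [folklore] -/
abbrev huPresentationMapOfLE' (r : ℕ) {M M' N : ℕ} (h' : M' ≤ M) (h : M ≤ N) :
    huPresentation X q r h ⟶ huPresentation X q r (h'.trans h) :=
  staircasePresentationMapOfLE' (algebraicDeRhamComplex X) q (antitone_staircase r M)
    (antitone_staircase r N) (staircase_le_staircase r h) (antitone_staircase r M')
    (staircase_le_staircase r h')

/-- The components of `huPresentationMapOfLE'` are `𝟙`, `deRhamStaircaseLE`, `huComplexLE`
(definitionally). [folklore] -/
theorem huPresentationMapOfLE'_τ (r : ℕ) {M M' N : ℕ} (h' : M' ≤ M) (h : M ≤ N) :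
    (huPresentationMapOfLE' X q r h' h).τ₁ = 𝟙 _ ∧
      (huPresentationMapOfLE' X q r h' h).τ₂ = deRhamStaircaseLE X q r h' ∧
        (huPresentationMapOfLE' X q r h' h).τ₃ = huComplexLE X q r h' N :=
  ⟨rfl, rfl, rfl⟩

/-! ### `ℤ`-indexed versions (the shape of hypercohomology) -/

/-- The staircase de Rham complex `q^{(r-•)M}Ω•` as a `ℤ`-indexed cochain complex (extension by zero
in negative degrees). [folklore] -/
abbrev deRhamStaircaseInt (r M : ℕ) :
    CochainComplex (Sheaf (Opens.grothendieckTopology X.left) AddCommGrpCat.{u}) ℤ :=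
  (deRhamStaircase X q r M).extend ComplexShape.embeddingUpNat

/-- `q^{(r-•)M}Ω•` (as a `ℤ`-complex) is strictly concentrated in degrees `≥ 0` (so its hyper-Ext /
hypercohomology is defined, `Algebra/Homology/HyperExt.hasHyperExt_of_isGE`). [folklore] -/
instance isStrictlyGE_deRhamStaircaseInt (r M : ℕ) : (deRhamStaircaseInt X q r M).IsStrictlyGE 0 :=
  inferInstance

/-- The inclusion `q^{(r-•)M'}Ω• ⟶ q^{(r-•)M}Ω•` (`M ≤ M'`) on the `ℤ`-indexed complexes. [folklore] -/
abbrev deRhamStaircaseIntLE (r : ℕ) {M M' : ℕ} (h : M ≤ M') :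
    deRhamStaircaseInt X q r M' ⟶ deRhamStaircaseInt X q r M :=
  HomologicalComplex.extendMap (deRhamStaircaseLE X q r h) ComplexShape.embeddingUpNat

/-- The inclusion `q^{(r-•)M}Ω• ⟶ Ω•` on the `ℤ`-indexed complexes. [folklore] -/
abbrev deRhamStaircaseIntι (r M : ℕ) :
    deRhamStaircaseInt X q r M ⟶ (algebraicDeRhamComplex X).extend ComplexShape.embeddingUpNat :=
  HomologicalComplex.extendMap (deRhamStaircaseι X q r M) ComplexShape.embeddingUpNat

/-- The projection `q^{(r-•)M}Ω• ⟶ p^{r,M}_{r,N}Ω•` on the `ℤ`-indexed complexes. [folklore] -/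
abbrev huComplexIntπ (r M N : ℕ) : deRhamStaircaseInt X q r M ⟶ huComplexInt X q r M N :=
  HomologicalComplex.extendMap (huComplexπ X q r M N) ComplexShape.embeddingUpNat

/-- Transitivity of the `ℤ`-extended inclusions. [folklore] -/
theorem deRhamStaircaseIntLE_comp (r : ℕ) {M M' M'' : ℕ} (h : M ≤ M') (h' : M' ≤ M'') :
    deRhamStaircaseIntLE X q r h' ≫ deRhamStaircaseIntLE X q r h =
      deRhamStaircaseIntLE X q r (h.trans h') := by
  rw [← HomologicalComplex.extendMap_comp, deRhamStaircaseLE_comp]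

/-- The `ℤ`-extended inclusion for `M ≤ M` is the identity. [folklore] -/
theorem deRhamStaircaseIntLE_refl (r M : ℕ) : deRhamStaircaseIntLE X q r (le_refl M) = 𝟙 _ := by
  rw [deRhamStaircaseIntLE, deRhamStaircaseLE_refl, HomologicalComplex.extendMap_id]

/-- The `ℤ`-extended projections are compatible with Hu's `ℤ`-extended reductions. [folklore] -/
theorem huComplexIntπ_comp_huComplexIntReduce (r M : ℕ) {N N' : ℕ} (h : N ≤ N') :
    huComplexIntπ X q r M N' ≫ huComplexIntReduce X q r M h = huComplexIntπ X q r M N := by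
  rw [← HomologicalComplex.extendMap_comp, huComplexπ_comp_huComplexReduce]

/-- The `ℤ`-extended projections are compatible with the `ℤ`-extended inclusions. [folklore] -/
theorem deRhamStaircaseIntLE_comp_huComplexIntπ (r : ℕ) {M M' : ℕ} (h : M' ≤ M) (N : ℕ) :
    deRhamStaircaseIntLE X q r h ≫ huComplexIntπ X q r M' N =
      huComplexIntπ X q r M N ≫ huComplexIntLE X q r h N := by
  rw [← HomologicalComplex.extendMap_comp, ← HomologicalComplex.extendMap_comp,
    deRhamStaircaseLE_comp_huComplexπ]

/-- **The `ℤ`-extended presentation** `q^{(r-•)N}Ω• ⟶ q^{(r-•)M}Ω• ⟶ p^{r,M}_{r,N}Ω•` (`M ≤ N`), a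
short complex of `ℤ`-indexed cochain complexes of abelian sheaves — the input of the long exact
hypercohomology sequence presenting `ℍⁱ(p^{r,M}_{r,N}Ω•)` (`KTheory.huH`). [folklore] -/
abbrev huPresentationInt (r : ℕ) {M N : ℕ} (h : M ≤ N) :
    ShortComplex (CochainComplex (Sheaf (Opens.grothendieckTopology X.left) AddCommGrpCat.{u}) ℤ) :=
  staircasePresentationShortComplexInt (algebraicDeRhamComplex X) q (antitone_staircase r M)
    (antitone_staircase r N) (staircase_le_staircase r h)

/-- The objects of the `ℤ`-extended presentation are `deRhamStaircaseInt X q r N`,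
`deRhamStaircaseInt X q r M` and LITERALLY `huComplexInt X q r M N` (definitionally). [folklore] -/
theorem huPresentationInt_X (r : ℕ) {M N : ℕ} (h : M ≤ N) :
    (huPresentationInt X q r h).X₁ = deRhamStaircaseInt X q r N ∧
      (huPresentationInt X q r h).X₂ = deRhamStaircaseInt X q r M ∧
        (huPresentationInt X q r h).X₃ = huComplexInt X q r M N :=
  ⟨rfl, rfl, rfl⟩

/-- The maps of the `ℤ`-extended presentation are `deRhamStaircaseIntLE` and `huComplexIntπ`
(definitionally). [folklore] -/
theorem huPresentationInt_f_g (r : ℕ) {M N : ℕ} (h : M ≤ N) :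
    (huPresentationInt X q r h).f = deRhamStaircaseIntLE X q r h ∧
      (huPresentationInt X q r h).g = huComplexIntπ X q r M N :=
  ⟨rfl, rfl⟩

/-- The objects of the `ℤ`-extended presentation are strictly concentrated in degrees `≥ 0`
(instances, for the hyper-Ext smallness conditions). [folklore] -/
instance isStrictlyGE_huPresentationInt_X₁ (r : ℕ) {M N : ℕ} (h : M ≤ N) :
    CochainComplex.IsStrictlyGE (huPresentationInt X q r h).X₁ 0 :=
  isStrictlyGE_deRhamStaircaseInt X q r N

/-- See `isStrictlyGE_huPresentationInt_X₁`. [folklore] -/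
instance isStrictlyGE_huPresentationInt_X₂ (r : ℕ) {M N : ℕ} (h : M ≤ N) :
    CochainComplex.IsStrictlyGE (huPresentationInt X q r h).X₂ 0 :=
  isStrictlyGE_deRhamStaircaseInt X q r M

/-- See `isStrictlyGE_huPresentationInt_X₁`. [folklore] -/
instance isStrictlyGE_huPresentationInt_X₃ (r : ℕ) {M N : ℕ} (h : M ≤ N) :
    CochainComplex.IsStrictlyGE (huPresentationInt X q r h).X₃ 0 :=
  isStrictlyGE_huComplexInt X q r M N

/-- **The `ℤ`-extended presentation `0 → q^{(r-•)N}Ω• → q^{(r-•)M}Ω• → p^{r,M}_{r,N}Ω• → 0` is short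
exact** (`M ≤ N`). [folklore] -/
theorem huPresentationInt_shortExact (r : ℕ) {M N : ℕ} (h : M ≤ N) :
    (huPresentationInt X q r h).ShortExact :=
  staircasePresentation_shortExact_extend _ _ _ _ _

/-- **Naturality of the `ℤ`-extended presentation over Hu's reductions** (`M ≤ N ≤ N'`): the
morphism of short complexes with components `deRhamStaircaseIntLE X q r h'`, `𝟙`,
`huComplexIntReduce X q r M h'`. [folklore] -/
abbrev huPresentationIntMapOfLE (r : ℕ) {M N N' : ℕ} (h : M ≤ N) (h' : N ≤ N') :
    huPresentationInt X q r (h.trans h') ⟶ huPresentationInt X q r h :=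
  (ComplexShape.embeddingUpNat.extendFunctor _).mapShortComplex.map (huPresentationMapOfLE X q r h h')

/-- The components of `huPresentationIntMapOfLE` are `deRhamStaircaseIntLE`, `𝟙`,
`huComplexIntReduce`. [folklore] -/
theorem huPresentationIntMapOfLE_τ (r : ℕ) {M N N' : ℕ} (h : M ≤ N) (h' : N ≤ N') :
    (huPresentationIntMapOfLE X q r h h').τ₁ = deRhamStaircaseIntLE X q r h' ∧
      (huPresentationIntMapOfLE X q r h h').τ₂ = 𝟙 _ ∧
        (huPresentationIntMapOfLE X q r h h').τ₃ = huComplexIntReduce X q r M h' := by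
  refine ⟨rfl, ?_, rfl⟩
  change HomologicalComplex.extendMap (𝟙 _) _ = _
  rw [HomologicalComplex.extendMap_id]
  rfl

/-- **Naturality of the `ℤ`-extended presentation over Hu's inclusions** (`M' ≤ M ≤ N`): the
morphism of short complexes with components `𝟙`, `deRhamStaircaseIntLE X q r h'`,
`huComplexIntLE X q r h' N`. [folklore] -/
abbrev huPresentationIntMapOfLE' (r : ℕ) {M M' N : ℕ} (h' : M' ≤ M) (h : M ≤ N) :
    huPresentationInt X q r h ⟶ huPresentationInt X q r (h'.trans h) :=
  (ComplexShape.embeddingUpNat.extendFunctor _).mapShortComplex.map (huPresentationMapOfLE' X q r h' h)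

/-- The components of `huPresentationIntMapOfLE'` are `𝟙`, `deRhamStaircaseIntLE`,
`huComplexIntLE`. [folklore] -/
theorem huPresentationIntMapOfLE'_τ (r : ℕ) {M M' N : ℕ} (h' : M' ≤ M) (h : M ≤ N) :
    (huPresentationIntMapOfLE' X q r h' h).τ₁ = 𝟙 _ ∧
      (huPresentationIntMapOfLE' X q r h' h).τ₂ = deRhamStaircaseIntLE X q r h' ∧
        (huPresentationIntMapOfLE' X q r h' h).τ₃ = huComplexIntLE X q r h' N := by
  refine ⟨?_, rfl, rfl⟩
  change HomologicalComplex.extendMap (𝟙 _) _ = _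
  rw [HomologicalComplex.extendMap_id]
  rfl

/-! ### Hu's three-term short exact sequences, `ℤ`-indexed -/

/-- Hu's three-term sequence `p^{r,M}_{r,N}Ω• ⟶ p^{r,M'}_{r,N}Ω• ⟶ p^{r,M'}_{r,M}Ω•` (`M' ≤ M ≤ N`) on
the `ℤ`-indexed complexes. [folklore] -/
abbrev huShortComplexInt (r : ℕ) {M M' N : ℕ} (hM : M' ≤ M) (hN : M ≤ N) :
    ShortComplex (CochainComplex (Sheaf (Opens.grothendieckTopology X.left) AddCommGrpCat.{u}) ℤ) :=
  (huShortComplex X q r hM hN).map (ComplexShape.embeddingUpNat.extendFunctor _)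

/-- The objects of the `ℤ`-indexed three-term sequence are `huComplexInt X q r M N`,
`huComplexInt X q r M' N`, `huComplexInt X q r M' M` (definitionally), and its maps are
`huComplexIntLE` and `huComplexIntReduce`. [folklore] -/
theorem huShortComplexInt_X (r : ℕ) {M M' N : ℕ} (hM : M' ≤ M) (hN : M ≤ N) :
    (huShortComplexInt X q r hM hN).X₁ = huComplexInt X q r M N ∧
      (huShortComplexInt X q r hM hN).X₂ = huComplexInt X q r M' N ∧
        (huShortComplexInt X q r hM hN).X₃ = huComplexInt X q r M' M ∧
          (huShortComplexInt X q r hM hN).f = huComplexIntLE X q r hM N ∧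
            (huShortComplexInt X q r hM hN).g = huComplexIntReduce X q r M' hN :=
  ⟨rfl, rfl, rfl, rfl, rfl⟩

/-- The objects of the `ℤ`-indexed three-term sequence are strictly concentrated in degrees `≥ 0`.
[folklore] -/
instance isStrictlyGE_huShortComplexInt_X₁ (r : ℕ) {M M' N : ℕ} (hM : M' ≤ M) (hN : M ≤ N) :
    CochainComplex.IsStrictlyGE (huShortComplexInt X q r hM hN).X₁ 0 :=
  isStrictlyGE_huComplexInt X q r M N

/-- See `isStrictlyGE_huShortComplexInt_X₁`. [folklore] -/
instance isStrictlyGE_huShortComplexInt_X₂ (r : ℕ) {M M' N : ℕ} (hM : M' ≤ M) (hN : M ≤ N) :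
    CochainComplex.IsStrictlyGE (huShortComplexInt X q r hM hN).X₂ 0 :=
  isStrictlyGE_huComplexInt X q r M' N

/-- See `isStrictlyGE_huShortComplexInt_X₁`. [folklore] -/
instance isStrictlyGE_huShortComplexInt_X₃ (r : ℕ) {M M' N : ℕ} (hM : M' ≤ M) (hN : M ≤ N) :
    CochainComplex.IsStrictlyGE (huShortComplexInt X q r hM hN).X₃ 0 :=
  isStrictlyGE_huComplexInt X q r M' M

/-- **Hu's three-term sequences are short exact on the `ℤ`-indexed complexes**:
`0 → p^{r,M}_{r,N}Ω• → p^{r,M'}_{r,N}Ω• → p^{r,M'}_{r,M}Ω• → 0` for `M' ≤ M ≤ N` (X. Hu,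
arXiv:2507.12458, §8) — the input of the long exact hypercohomology sequences
`⋯ → ℍⁱ(p^{r,M}_{r,N}) → ℍⁱ(p^{r,M'}_{r,N}) → ℍⁱ(p^{r,M'}_{r,M}) → ℍⁱ⁺¹(p^{r,M}_{r,N}) → ⋯`.
[folklore] -/
theorem hu_shortExact_int (r : ℕ) {M M' N : ℕ} (hM : M' ≤ M) (hN : M ≤ N) :
    (huShortComplexInt X q r hM hN).ShortExact :=
  shortExact_map_extendFunctor _ (hu_shortExact X q r hM hN)

end Literature.AlgebraicGeometry.Crystalline

end
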